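import Summits.RiemannHypothesis.RiemannHypothesis.Theorems.MotivicDoorDecreeAsymmetry
import HarnessLib

/-!
# Motivic door (Connes–Consani): `N` on the additive side — linearity, positivity off `u = 1`,
# the Lévy–Khintchine form, and the order-one window bound

Honest framing (cell `pub-rhdoor`, cc-3, verbatim): "lottery ticket at the motivic door; RH
probability negligible; consolation prizes are real: a new semi-local Weil-positivity theorem, or
a located gap in the Connes–Consani programme, plus the ff-door theorem".  VERDICT (ref-1,
ref-2): `Nonempty ArithmeticWeilSurface` is a restatement of RH in structure clothing.  No RH
content below; value = theorem (RH-free infrastructure for the located-gap item G3′: what the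
decreed pairing `D • D' := N(D ⋆ D̃')` does AT the diagonal against a fixed divisor — files
`MotivicDoorApproxIdentityKernel`, `MotivicDoorDecreeDiagonalClass`).

For a real test `κ` on the additive line, `N(toMul κ)` is CC's distribution `N`
(arXiv:1805.10501 §3.1; Connes, arXiv:1509.05576 §4.1 eq. (25)–(28)) paired with
`u ↦ u^{-1/2} κ(log u)`; `two_mul_ccN_toMul` (file `MotivicDoorDecreeOffDiagonal`) is its
one-sided additive form.  This file records:

PROVED
* `ccN_toMul_const_mul`, `ccN_toMul_sub`, `ccN_toMul_add`: `κ ↦ N(toMul κ)` is linear on real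
  Weil tests (prime sum: `summable_vonMangoldt_mul_toMul`; archimedean integrand:
  `integrableOn_ccArchIntegrand`).
* `ccN_toMul_nonneg`, `ccN_toMul_mono`: `κ ≥ 0 ∧ κ(0) = 0 ⟹ N(toMul κ) ≥ 0` — away from the
  point `u = 1` (length `t = 0`) `N` is a positive measure (Connes, loc. cit. p. 14: "the
  distribution `N(u)` is positive on `(1, ∞)`", while "one should expect `N(1) = −∞`").
* `two_mul_ccN_toMul_eq_markov` (**Lévy–Khintchine form**): for `κ` vanishing on `[2a, ∞)`,
  `2N(toMul κ) = M_a κ(0) − 2 Σ_{log n < 2a} Λ(n) n^{-1/2} (κ(0) − κ(log n))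
     − 2 ∫₀^∞ e^{t/2}/(2 sinh t) (κ(0) − κ(t)) dt`,
  `M_a = weilMarkovConstant a` the killing constant of Bombieri's explicit formula on the window
  (`Literature…WeilMarkovQuadratic`): a one-sided killed pure-jump form — jump rates
  `Λ(n) n^{-1/2}` at the lengths `log n`, jump density `e^{t/2}/(2 sinh t)` at every `t > 0`.
* `mul_weilArchDensity_le_one`: `t e^{t/2}/(2 sinh t) ≤ 1` on `(0, 1]`.
* `abs_two_mul_ccN_toMul_le` (**order-one window bound**): with `|κ| ≤ M₀` and
  `|κ(t) − κ(0)| ≤ M₁ t` on `(0, 1]`,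
  `|2N(toMul κ)| ≤ (|M_a| + 4 Σ_{log n < 2a} Λ(n) n^{-1/2} + 4 ∫₁^∞ e^{t/2} dt/(2 sinh t)) M₀
     + 2 M₁`:
  `N(toMul ·)` is continuous for "sup norm + Lipschitz constant at `t = 0`", a distribution of
  order `≤ 1` whose order-one part sits at the single length `t = 0` (the diagonal point).

References: Bombieri 2000, Thm 2; Connes, arXiv:1509.05576 §4.1; Connes–Consani,
arXiv:1805.10501 §3.1.
-/

noncomputable section

set_option linter.dupNamespace false

open Complex Set MeasureTheory Filter Topology Literature.NumberTheory.LFunctions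
open Literature.NumberTheory.ConnesConsani2019
open scoped Real ComplexConjugate ArithmeticFunction.vonMangoldt

namespace Summit.RiemannHypothesis.RiemannHypothesis.Theorems.MotivicDoor.ConnesConsani

/-! ## 1. Linearity of `κ ↦ N(toMul κ)` -/

section Linearity

variable {κ κ₁ κ₂ : ℝ → ℝ}

/-- `toMul` is linear: differences.  PROVED. -/
theorem toMul_sub_apply (κ₁ κ₂ : ℝ → ℝ) (x : ℝ) :
    toMul (fun t ↦ κ₁ t - κ₂ t) x = toMul κ₁ x - toMul κ₂ x := by
  simp only [toMul]
  ring

/-- `toMul` is linear: scalars.  PROVED. -/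
theorem toMul_const_mul_apply (c : ℝ) (κ : ℝ → ℝ) (x : ℝ) :
    toMul (fun t ↦ c * κ t) x = c * toMul κ x := by
  simp only [toMul]
  ring

/-- **`N(toMul (c κ)) = c N(toMul κ)`** (no hypothesis on `κ`).  PROVED. -/
theorem ccN_toMul_const_mul (c : ℝ) (κ : ℝ → ℝ) :
    ccN (toMul fun t ↦ c * κ t) = c * ccN (toMul κ) := by
  unfold ccN
  simp only [toMul_const_mul_apply]
  have hs : ∑' n : ℕ, Λ n * (c * toMul κ n) = c * ∑' n : ℕ, Λ n * toMul κ n := by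
    rw [← tsum_mul_left]
    exact tsum_congr fun n ↦ by ring
  have hi : ∫ u in Ioi (1 : ℝ), (u ^ 2 * (c * toMul κ u) - c * toMul κ 1) / (u ^ 2 - 1) / u =
      c * ∫ u in Ioi (1 : ℝ), (u ^ 2 * toMul κ u - toMul κ 1) / (u ^ 2 - 1) / u := by
    rw [← integral_const_mul]
    exact setIntegral_congr_fun measurableSet_Ioi fun u _ ↦ by ring
  rw [hs, hi]
  ring

/-- The full one-sided integrand of `two_mul_ccN_toMul` is integrable for a Weil test.
PROVED. -/
theorem integrableOn_ccFullIntegrand (hκ : IsWeilTest fun t ↦ (κ t : ℂ)) :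
    IntegrableOn (fun t ↦ (Real.exp (t / 2) * (2 * κ t) - 2 * κ 0) / (2 * Real.sinh t) +
      2 * κ 0 / (Real.exp t + 1)) (Ioi 0) :=
  (integrableOn_ccArchIntegrand κ hκ).add (integrableOn_const_div_exp_add_one (2 * κ 0))

/-- **`N(toMul (κ₁ − κ₂)) = N(toMul κ₁) − N(toMul κ₂)`** for Weil tests `κ₁, κ₂`.  PROVED. -/
theorem ccN_toMul_sub (hκ₁ : IsWeilTest fun t ↦ (κ₁ t : ℂ))
    (hκ₂ : IsWeilTest fun t ↦ (κ₂ t : ℂ)) :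
    ccN (toMul fun t ↦ κ₁ t - κ₂ t) = ccN (toMul κ₁) - ccN (toMul κ₂) := by
  have h := two_mul_ccN_toMul (fun t ↦ κ₁ t - κ₂ t)
  have h₁ := two_mul_ccN_toMul κ₁
  have h₂ := two_mul_ccN_toMul κ₂
  have hs : ∑' n : ℕ, Λ n * toMul (fun t ↦ κ₁ t - κ₂ t) n =
      (∑' n : ℕ, Λ n * toMul κ₁ n) - ∑' n : ℕ, Λ n * toMul κ₂ n := by
    rw [← (summable_vonMangoldt_mul_toMul hκ₁).tsum_sub (summable_vonMangoldt_mul_toMul hκ₂)]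
    exact tsum_congr fun n ↦ by rw [toMul_sub_apply]; ring
  have hi : ∫ t in Ioi (0 : ℝ), ((Real.exp (t / 2) * (2 * (κ₁ t - κ₂ t)) -
      2 * (κ₁ 0 - κ₂ 0)) / (2 * Real.sinh t) + 2 * (κ₁ 0 - κ₂ 0) / (Real.exp t + 1)) =
      (∫ t in Ioi (0 : ℝ), ((Real.exp (t / 2) * (2 * κ₁ t) - 2 * κ₁ 0) / (2 * Real.sinh t) +
        2 * κ₁ 0 / (Real.exp t + 1))) -
      ∫ t in Ioi (0 : ℝ), ((Real.exp (t / 2) * (2 * κ₂ t) - 2 * κ₂ 0) / (2 * Real.sinh t) +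
        2 * κ₂ 0 / (Real.exp t + 1)) := by
    rw [← integral_sub (integrableOn_ccFullIntegrand hκ₁) (integrableOn_ccFullIntegrand hκ₂)]
    exact setIntegral_congr_fun measurableSet_Ioi fun t _ ↦ by ring
  rw [hs, hi] at h
  linear_combination (h - h₁ + h₂) / 2

/-- **`N(toMul (κ₁ + κ₂)) = N(toMul κ₁) + N(toMul κ₂)`** for Weil tests.  PROVED. -/
theorem ccN_toMul_add (hκ₁ : IsWeilTest fun t ↦ (κ₁ t : ℂ))
    (hκ₂ : IsWeilTest fun t ↦ (κ₂ t : ℂ)) :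
    ccN (toMul fun t ↦ κ₁ t + κ₂ t) = ccN (toMul κ₁) + ccN (toMul κ₂) := by
  have hκ₂' : IsWeilTest fun t ↦ ((-1 * κ₂ t : ℝ) : ℂ) := by
    have := hκ₂.const_mul (-1)
    convert this using 1
    funext t
    push_cast
    ring
  have h := ccN_toMul_sub hκ₁ hκ₂'
  have e : (fun t ↦ κ₁ t - -1 * κ₂ t) = fun t ↦ κ₁ t + κ₂ t := funext fun t ↦ by ring
  rw [e, ccN_toMul_const_mul] at h
  linarith

end Linearity

/-! ## 2. Positivity of `N` off the point `u = 1` -/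

section Positivity

variable {κ κ₁ κ₂ : ℝ → ℝ}

/-- **Naive positivity** (`N` is a positive measure on `(1, ∞)`): `κ ≥ 0` with `κ(0) = 0` gives
`N(toMul κ) ≥ 0`.  PROVED (termwise; no integrability needed). -/
theorem ccN_toMul_nonneg (hnn : ∀ t, 0 ≤ κ t) (h0 : κ 0 = 0) : 0 ≤ ccN (toMul κ) := by
  have hmul : ∀ x, 0 ≤ x → 0 ≤ toMul κ x := fun x hx ↦
    mul_nonneg (Real.rpow_nonneg hx _) (hnn _)
  have h1 : toMul κ 1 = 0 := by rw [toMul_one, h0]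
  unfold ccN
  rw [h1]
  refine add_nonneg (add_nonneg (tsum_nonneg fun n ↦ ?_) (setIntegral_nonneg measurableSet_Ioi
    fun u hu ↦ ?_)) (by simp)
  · exact mul_nonneg ArithmeticFunction.vonMangoldt_nonneg (hmul _ (Nat.cast_nonneg n))
  · have hu1 : (1 : ℝ) < u := hu
    have hpos : 0 < u ^ 2 - 1 := by nlinarith
    rw [sub_zero]
    exact div_nonneg (div_nonneg (mul_nonneg (sq_nonneg _) (hmul u (by linarith))) hpos.le)
      (by linarith)

/-- **Monotonicity**: Weil tests `κ₁ ≤ κ₂` agreeing at `0` have `N(toMul κ₁) ≤ N(toMul κ₂)`.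
PROVED. -/
theorem ccN_toMul_mono (hκ₁ : IsWeilTest fun t ↦ (κ₁ t : ℂ))
    (hκ₂ : IsWeilTest fun t ↦ (κ₂ t : ℂ)) (hle : ∀ t, κ₁ t ≤ κ₂ t) (h0 : κ₁ 0 = κ₂ 0) :
    ccN (toMul κ₁) ≤ ccN (toMul κ₂) := by
  have h := ccN_toMul_sub hκ₂ hκ₁
  have hnn := ccN_toMul_nonneg (κ := fun t ↦ κ₂ t - κ₁ t) (fun t ↦ sub_nonneg.2 (hle t))
    (by simp [h0])
  linarith

end Positivity

/-! ## 3. The Lévy–Khintchine (killed jump) form of `N(toMul κ)` and the window bound -/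

section Markov

variable {κ : ℝ → ℝ}

/-- `log 4π = 2 log 2 + log π`.  PROVED. -/
private theorem log_four_pi : Real.log (4 * π) = 2 * Real.log 2 + Real.log π := by
  rw [Real.log_mul (by norm_num) Real.pi_pos.ne', show (4 : ℝ) = 2 ^ 2 by norm_num,
    Real.log_pow]
  push_cast
  ring

/-- The density part `w(t) (κ(t) − κ(0))` of the one-sided integrand is integrable.  PROVED. -/
theorem integrableOn_weilArchDensity_mul_sub (hκ : IsWeilTest fun t ↦ (κ t : ℂ)) :
    IntegrableOn (fun t ↦ weilArchDensity t * (κ t - κ 0)) (Ioi 0) := by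
  have h := ((integrableOn_ccArchIntegrand κ hκ).sub
    (integrableOn_weilKillingDensity.const_mul (2 * κ 0))).const_mul (1 / 2)
  refine IntegrableOn.congr_fun h (fun t ht ↦ ?_) measurableSet_Ioi
  have hs : (2 : ℝ) * Real.sinh t ≠ 0 := (mul_pos two_pos (Real.sinh_pos_iff.2 ht)).ne'
  show 1 / 2 * ((Real.exp (t / 2) * (2 * κ t) - 2 * κ 0) / (2 * Real.sinh t) -
    2 * κ 0 * ((Real.exp (t / 2) - 1) / (2 * Real.sinh t))) = weilArchDensity t * (κ t - κ 0)
  simp only [weilArchDensity]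
  field_simp
  ring

/-- **Lévy–Khintchine form of `N` on the additive side.**  For a real Weil test `κ` vanishing
on `[2a, ∞)`:
`2 N(toMul κ) = M_a κ(0) − 2 Σ_{log n < 2a} Λ(n) n^{-1/2} (κ(0) − κ(log n))
  − 2 ∫₀^∞ e^{t/2}/(2 sinh t) (κ(0) − κ(t)) dt`,
`M_a = weilMarkovConstant a` the killing constant of the window (Bombieri's explicit formula
read as a killed pure-jump generator; `N` charges only lengths `t ≥ 0`).  PROVED. -/
theorem two_mul_ccN_toMul_eq_markov (hκ : IsWeilTest fun t ↦ (κ t : ℂ)) {a : ℝ}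
    (hκa : ∀ t, 2 * a ≤ t → κ t = 0) :
    2 * ccN (toMul κ) = weilMarkovConstant a * κ 0 -
      2 * (∑ n ∈ weilPrimeIndex a, (Λ n : ℝ) / Real.sqrt n * (κ 0 - κ (Real.log n))) -
      2 * ∫ t in Ioi (0 : ℝ), weilArchDensity t * (κ 0 - κ t) := by
  have h := two_mul_ccN_toMul κ
  -- prime side
  have hvan : ∀ n ∉ weilPrimeIndex a, (Λ n : ℝ) * toMul κ n = 0 := by
    intro n hn
    rw [mem_weilPrimeIndex, not_lt] at hn
    rcases Nat.eq_zero_or_pos n with rfl | hn0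
    · simp
    · rw [toMul_natCast κ hn0, hκa _ hn, zero_div, mul_zero]
  have hs : ∑' n : ℕ, Λ n * toMul κ n =
      ∑ n ∈ weilPrimeIndex a, (Λ n : ℝ) / Real.sqrt n * κ (Real.log n) := by
    rw [tsum_eq_sum hvan]
    refine Finset.sum_congr rfl fun n _ ↦ ?_
    rcases Nat.eq_zero_or_pos n with rfl | hn0
    · simp
    · rw [toMul_natCast κ hn0]
      ring
  -- archimedean side
  have hI1 : ∫ t in Ioi (0 : ℝ), ((Real.exp (t / 2) * (2 * κ t) - 2 * κ 0) / (2 * Real.sinh t) +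
      2 * κ 0 / (Real.exp t + 1)) =
      (∫ t in Ioi (0 : ℝ), (Real.exp (t / 2) * (2 * κ t) - 2 * κ 0) / (2 * Real.sinh t)) +
        ∫ t in Ioi (0 : ℝ), 2 * κ 0 / (Real.exp t + 1) :=
    integral_add (integrableOn_ccArchIntegrand κ hκ) (integrableOn_const_div_exp_add_one _)
  have hI2 : ∫ t in Ioi (0 : ℝ), 2 * κ 0 / (Real.exp t + 1) = 2 * κ 0 * Real.log 2 := by
    rw [← integral_Ioi_one_div_exp_add_one, ← integral_const_mul]
    exact setIntegral_congr_fun measurableSet_Ioi fun t _ ↦ by ring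
  have hI3 : ∫ t in Ioi (0 : ℝ), (Real.exp (t / 2) * (2 * κ t) - 2 * κ 0) / (2 * Real.sinh t) =
      2 * (∫ t in Ioi (0 : ℝ), weilArchDensity t * (κ t - κ 0)) +
        2 * κ 0 * ∫ t in Ioi (0 : ℝ), (Real.exp (t / 2) - 1) / (2 * Real.sinh t) := by
    rw [← integral_const_mul, ← integral_const_mul, ← integral_add
      ((integrableOn_weilArchDensity_mul_sub hκ).const_mul 2)
      (integrableOn_weilKillingDensity.const_mul (2 * κ 0))]
    refine setIntegral_congr_fun measurableSet_Ioi fun t ht ↦ ?_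
    have hsh : (2 : ℝ) * Real.sinh t ≠ 0 := (mul_pos two_pos (Real.sinh_pos_iff.2 ht)).ne'
    simp only [weilArchDensity]
    field_simp
    ring
  have hI4 : ∫ t in Ioi (0 : ℝ), weilArchDensity t * (κ t - κ 0) =
      -∫ t in Ioi (0 : ℝ), weilArchDensity t * (κ 0 - κ t) := by
    rw [← integral_neg]
    exact setIntegral_congr_fun measurableSet_Ioi fun t _ ↦ by ring
  rw [hs, hI1, hI2, hI3, hI4] at h
  have hM : weilMarkovConstant a = 2 * (∑ n ∈ weilPrimeIndex a, (Λ n : ℝ) / Real.sqrt n) +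
      2 * (∫ t in Ioi (0 : ℝ), (Real.exp (t / 2) - 1) / (2 * Real.sinh t)) +
      (2 * Real.log 2 + Real.log π + Real.eulerMascheroniConstant) := by
    rw [weilMarkovConstant, log_four_pi]
  have hsum : ∑ n ∈ weilPrimeIndex a, (Λ n : ℝ) / Real.sqrt n * (κ 0 - κ (Real.log n)) =
      κ 0 * (∑ n ∈ weilPrimeIndex a, (Λ n : ℝ) / Real.sqrt n) -
        ∑ n ∈ weilPrimeIndex a, (Λ n : ℝ) / Real.sqrt n * κ (Real.log n) := by
    rw [Finset.mul_sum, ← Finset.sum_sub_distrib]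
    exact Finset.sum_congr rfl fun n _ ↦ by ring
  rw [hM, hsum]
  linear_combination h

/-- `t · e^{t/2}/(2 sinh t) ≤ 1` on `(0, 1]` (`sinh t ≥ t`, `e^{1/2} ≤ 2`).  PROVED. -/
theorem mul_weilArchDensity_le_one {t : ℝ} (ht : 0 < t) (ht1 : t ≤ 1) :
    t * weilArchDensity t ≤ 1 := by
  have h1 := weilArchDensity_le_exp_half_div ht
  have h2 : Real.exp (t / 2) ≤ 2 := by
    have := Real.exp_one_lt_d9
    have h3 : Real.exp (t / 2) ≤ Real.exp (1 / 2) := Real.exp_le_exp.2 (by linarith)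
    have h4 : Real.exp (1 / 2) ^ 2 = Real.exp 1 := by rw [← Real.exp_nat_mul]; norm_num
    nlinarith [Real.exp_pos (1 / 2)]
  calc t * weilArchDensity t ≤ t * (Real.exp (t / 2) / (2 * t)) :=
        mul_le_mul_of_nonneg_left h1 ht.le
    _ = Real.exp (t / 2) / 2 := by field_simp
    _ ≤ 1 := by linarith

/-- **Window bound: `N` is a distribution of order `≤ 1` at `t = 0` and of order `0`
elsewhere.**  For a real Weil test `κ` vanishing on `[2a, ∞)` with `|κ| ≤ M₀` and
`|κ(t) − κ(0)| ≤ M₁ t` on `(0, 1]`: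
`|2 N(toMul κ)| ≤ (|M_a| + 4 Σ_{log n < 2a} Λ(n) n^{-1/2} + 4 ∫₁^∞ e^{t/2} dt/(2 sinh t)) M₀
  + 2 M₁`.  PROVED. -/
theorem abs_two_mul_ccN_toMul_le (hκ : IsWeilTest fun t ↦ (κ t : ℂ)) {a : ℝ}
    (hκa : ∀ t, 2 * a ≤ t → κ t = 0) {M₀ M₁ : ℝ} (hM₀ : ∀ t, |κ t| ≤ M₀)
    (hM₁ : ∀ t ∈ Ioc (0 : ℝ) 1, |κ t - κ 0| ≤ M₁ * t) :
    |2 * ccN (toMul κ)| ≤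
      (|weilMarkovConstant a| + 4 * (∑ n ∈ weilPrimeIndex a, (Λ n : ℝ) / Real.sqrt n) +
        4 * ∫ t in Ioi (1 : ℝ), weilArchDensity t) * M₀ + 2 * M₁ := by
  have hM₀nn : 0 ≤ M₀ := (abs_nonneg _).trans (hM₀ 0)
  have hM₁nn : 0 ≤ M₁ := by
    have := hM₁ 1 ⟨one_pos, le_rfl⟩
    rw [mul_one] at this
    exact (abs_nonneg _).trans this
  rw [two_mul_ccN_toMul_eq_markov hκ hκa]
  -- prime sum
  have hP : |∑ n ∈ weilPrimeIndex a, (Λ n : ℝ) / Real.sqrt n * (κ 0 - κ (Real.log n))| ≤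
      (∑ n ∈ weilPrimeIndex a, (Λ n : ℝ) / Real.sqrt n) * (2 * M₀) := by
    rw [Finset.sum_mul]
    refine (Finset.abs_sum_le_sum_abs _ _).trans (Finset.sum_le_sum fun n _ ↦ ?_)
    have hc : 0 ≤ (Λ n : ℝ) / Real.sqrt n :=
      div_nonneg ArithmeticFunction.vonMangoldt_nonneg (Real.sqrt_nonneg _)
    rw [abs_mul, abs_of_nonneg hc]
    refine mul_le_mul_of_nonneg_left ?_ hc
    calc |κ 0 - κ (Real.log n)| ≤ |κ 0| + |κ (Real.log n)| := abs_sub _ _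
      _ ≤ M₀ + M₀ := add_le_add (hM₀ _) (hM₀ _)
      _ = 2 * M₀ := by ring
  -- archimedean integral, split at `t = 1`
  have hint := integrableOn_weilArchDensity_mul_sub hκ
  have hint' : IntegrableOn (fun t ↦ weilArchDensity t * (κ 0 - κ t)) (Ioi 0) := by
    refine IntegrableOn.congr_fun hint.neg (fun t _ ↦ ?_) measurableSet_Ioi
    simp only [Pi.neg_apply]
    ring
  have hsplit : ∫ t in Ioi (0 : ℝ), weilArchDensity t * (κ 0 - κ t) =
      (∫ t in Ioc (0 : ℝ) 1, weilArchDensity t * (κ 0 - κ t)) +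
        ∫ t in Ioi (1 : ℝ), weilArchDensity t * (κ 0 - κ t) := by
    rw [← Ioc_union_Ioi_eq_Ioi zero_le_one, setIntegral_union (Set.Ioc_disjoint_Ioi le_rfl)
      measurableSet_Ioi (hint'.mono_set Ioc_subset_Ioi_self)
      (hint'.mono_set (Ioi_subset_Ioi zero_le_one))]
  have hA : |∫ t in Ioc (0 : ℝ) 1, weilArchDensity t * (κ 0 - κ t)| ≤ M₁ := by
    have h := norm_setIntegral_le_of_norm_le_const
      (f := fun t ↦ weilArchDensity t * (κ 0 - κ t)) (s := Ioc (0 : ℝ) 1) (C := M₁)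
      (μ := volume) (by simp) fun t ht ↦ by
        rw [Real.norm_eq_abs, abs_mul, abs_of_pos (weilArchDensity_pos ht.1), abs_sub_comm]
        calc weilArchDensity t * |κ t - κ 0| ≤ weilArchDensity t * (M₁ * t) :=
            mul_le_mul_of_nonneg_left (hM₁ t ht) (weilArchDensity_pos ht.1).le
          _ = M₁ * (t * weilArchDensity t) := by ring
          _ ≤ M₁ * 1 :=
            mul_le_mul_of_nonneg_left (mul_weilArchDensity_le_one ht.1 ht.2) hM₁nn
          _ = M₁ := mul_one _
    rw [Real.norm_eq_abs, Real.volume_real_Ioc_of_le zero_le_one, sub_zero, mul_one] at h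
    exact h
  have hB : |∫ t in Ioi (1 : ℝ), weilArchDensity t * (κ 0 - κ t)| ≤
      (∫ t in Ioi (1 : ℝ), weilArchDensity t) * (2 * M₀) := by
    rw [← integral_mul_const]
    have h := norm_integral_le_of_norm_le (μ := volume.restrict (Ioi (1 : ℝ)))
      (f := fun t ↦ weilArchDensity t * (κ 0 - κ t))
      (g := fun t ↦ weilArchDensity t * (2 * M₀))
      ((integrableOn_weilArchDensity_Ioi one_pos).mul_const _)
      ((ae_restrict_iff' measurableSet_Ioi).2 (Eventually.of_forall
        fun t (ht : (1 : ℝ) < t) ↦ by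
          rw [Real.norm_eq_abs, abs_mul, abs_of_pos (weilArchDensity_pos (one_pos.trans ht))]
          refine mul_le_mul_of_nonneg_left ?_ (weilArchDensity_pos (one_pos.trans ht)).le
          calc |κ 0 - κ t| ≤ |κ 0| + |κ t| := abs_sub _ _
            _ ≤ M₀ + M₀ := add_le_add (hM₀ _) (hM₀ _)
            _ = 2 * M₀ := by ring))
    rw [Real.norm_eq_abs] at h
    exact h
  rw [hsplit]
  have hMa : |weilMarkovConstant a * κ 0| ≤ |weilMarkovConstant a| * M₀ := by
    rw [abs_mul]
    exact mul_le_mul_of_nonneg_left (hM₀ 0) (abs_nonneg _)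
  calc |weilMarkovConstant a * κ 0 -
        2 * ∑ n ∈ weilPrimeIndex a, (Λ n : ℝ) / Real.sqrt n * (κ 0 - κ (Real.log n)) -
        2 * ((∫ t in Ioc (0 : ℝ) 1, weilArchDensity t * (κ 0 - κ t)) +
          ∫ t in Ioi (1 : ℝ), weilArchDensity t * (κ 0 - κ t))|
      ≤ |weilMarkovConstant a * κ 0| +
        2 * |∑ n ∈ weilPrimeIndex a, (Λ n : ℝ) / Real.sqrt n * (κ 0 - κ (Real.log n))| +
        2 * (|∫ t in Ioc (0 : ℝ) 1, weilArchDensity t * (κ 0 - κ t)| +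
          |∫ t in Ioi (1 : ℝ), weilArchDensity t * (κ 0 - κ t)|) := by
        refine (abs_sub _ _).trans (add_le_add ((abs_sub _ _).trans (add_le_add le_rfl ?_)) ?_)
        · rw [abs_mul, abs_two]
        · rw [abs_mul, abs_two]
          exact mul_le_mul_of_nonneg_left (abs_add_le _ _) zero_le_two
    _ ≤ |weilMarkovConstant a| * M₀ +
        2 * ((∑ n ∈ weilPrimeIndex a, (Λ n : ℝ) / Real.sqrt n) * (2 * M₀)) +
        2 * (M₁ + (∫ t in Ioi (1 : ℝ), weilArchDensity t) * (2 * M₀)) := by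
        gcongr
    _ = _ := by ring

end Markov

end Summit.RiemannHypothesis.RiemannHypothesis.Theorems.MotivicDoor.ConnesConsani
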